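import HarnessLib
import Literature.MathematicalPhysics.QuantumFieldTheory.Balaban1983to89.Beta.SliceLegsWindow
import Literature.MathematicalPhysics.QuantumFieldTheory.Balaban1983to89.Beta.LeafBlockLegsMassless

/-!
# Beta / SliceLegsScalar — the (W3a)₀ TAIL binders `hFtail` / `hGtail` of the composed road, HYPOTHESIS-FREE for the
# three one-loop legs of Bałaban's MASSLESS SCALAR torus tower at `d = 4`

HONEST FRAMING (verbatim, page 1 of everything this cell writes): discharging `BetaPertH` makes Bałaban's UV
stability UNCONDITIONAL — a real constructive-QFT result; it is NOT the continuum limit and NOT the Clay problem.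
ABSOLUTE RULE: no internally-minted statement enters as a cited fact; every hypothesis below is either kernel-proved in
the tree or an explicit hypothesis of the theorem that uses it.  THIS MODULE asserts nothing printed: it is a one-screen
COMBINATION of tree certificates about the concrete SCALAR (`U = 1`), MASSLESS (`m² = 0`) torus tower
`B1RG242Torus.tower P a 0` at `d = 4`.  Zero cited facts, zero `sorry`.
SCOPE DISCIPLINE (GAPS G-beta-21): KERNEL FOR A SCALAR `U = 1` MODEL.  That these `Pt`-families (their window sums,
their near field) are the legs of Bałaban's YM₄ one-loop coefficient `β̄_k` is the identification item (W3b)₀ of the an2 lane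
(binders `hF`/`hG`/`hident` of `ComposedRoad` §8) and is NOT asserted here.

WHAT IS PROVED.  For every odd `L > 1` and every `a > 0` there are constants `δ > 0`, `R₂, R₃, R₄ ≥ 0` — chosen from
`(L, a)` ALONE, before any volume / cutoff / base-point data — such that for EVERY tower sequence
`𝒯 : SliceLegsWindow.TowerSeq L` (towers `Pf m` with `d = 4`, the fixed `L`, `m ≤ (Pf m).m + (Pf m).K + 1` levels, base points
`x₀ m`) and every window floor `M`, the six binders
  `∀ m ≥ 1, ∀ r, M (L^m) ≤ r → ∀ w ∈ annulus 4 r (r+1), |𝒯.valueF a 0 (L^m) w| ≤ R₂/((r:ℝ)+1)^2 · Real.exp (−(δ/((L^m : ℕ) : ℝ))·((r:ℝ)+1))`,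
  `… ≤ R₂/((r:ℝ)+1)^2`, and the same for `𝒯.gradF a 0 μ` (`R₃`, cube) and `𝒯.mixedF a 0 μ ν` (`R₄`, fourth power)
hold (`scalarTails`; the six members separately as `valueF_hFtail`, …, under the named package `ScalarPkg`).  These are,
literally, the shapes of the binders `hFtail` / `hGtail` of `ComposedRoad.oneLoopDrift_of_composedLegInterfacePow` for one
leg index (`F' i := 𝒯.valueF a 0`, `R' i := R₂`, `(P i).a = 2`, `Lc := L`, …).
PROOF = names only: pv23's `LeafBlockLegsMassless.blockLegDecay_massless 4 L` (value + gradient block legs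
`Beta/LeafBlockLegs`, covariance pv07's `B4Ineq116Torus.cov116_torus`, all at `m² = 0`) ⟹ one uniform package
`BlockLegDecay (Pf m) a 0 c δ`; `BlockLegDecay.mono` to `(max c (cK0 4 L a 0), min δ (dK0 4 L a 0))`; `ā := a` by
`B1.aSeq_le` (and `aSeq a L 0 = 0`, Lean's value at the vanishing denominator); then an1's
`SliceLegsWindow.TowerSeq.{value,grad,mixed}Leg_hFtail/_hGtail`.

HONEST SCOPE / WHAT THIS DOES NOT DO.  `m² = 0`, `d = 4`, scalar `U = 1` only; TAIL binders only — the near-field binders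
`hF`/`hG` and the identification `hident` of the road are an2's (W3b)₀; nothing about the vector / ghost towers (an3/an4).
The constants are not evaluated (they contain pv23's existential `Kleg 4` and pv07's `(δ₀, c₀)` of (1.16)).
Context (orientation only; not used in proofs): [B5] p. 40 (1.136)–(1.137); [B4] p. 582 Lemma 2.4 (2.35)–(2.37).
B4 = [cite: Balaban1983RegularityDecay]; B5 = [cite: Balaban1984PropagatorsI].
-/

namespace Literature.MathematicalPhysics.QuantumFieldTheory.Balaban1983to89

noncomputable section

namespace Beta.SliceLegsScalar

open B5Leaf237C0Torus (cK0 dK0)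
open Beta.DyadicShell (Pt)
open Beta.SliceLegs (legConst legConst_nonneg)
open Beta.LeafK123Clauses (BlockLegDecay)
open Beta.SliceLegsWindow (TowerSeq legConst_eq_of_eq)
open Beta.LeafBlockLegsMassless (blockLegDecay_massless)
open Literature.Probability.LatticeModels (annulus)

/-! ## §1. Reference parameters and the bound on Bałaban's `a_j` -/

/-- A reference parameter record `(d, L, m, K) = (4, L, 0, 0)`, used only to NAME constants depending on `(4, L)`. [folklore] -/
def refParams (L : ℕ) (hL : Odd L ∧ 1 < L) : Params where
  d := 4
  L := L
  m := 0
  K := 0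
  hd := by norm_num
  hL := hL

/-- Its dimension field. [folklore] -/
@[simp] theorem refParams_d (L : ℕ) (hL : Odd L ∧ 1 < L) : (refParams L hL).d = 4 := rfl

/-- Its blocking-factor field. [folklore] -/
@[simp] theorem refParams_L (L : ℕ) (hL : Odd L ∧ 1 < L) : (refParams L hL).L = L := rfl

/-- `|a_j| ≤ a` for ALL `j : ℕ` (`a > 0`, `L > 1`): for `j ≥ 1` this is `B1.aSeq_le` with `aSeq_pos`; at `j = 0` the closed
form (2.15) has a vanishing denominator and Lean's value is `0`. [folklore] -/
theorem abs_aSeq_le {a : ℝ} (ha : 0 < a) {L : ℝ} (hL : 1 < L) (j : ℕ) : |B1.aSeq a L j| ≤ a := by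
  rcases Nat.eq_zero_or_pos j with rfl | hj
  · have h0 : B1.aSeq a L 0 = 0 := by simp [B1.aSeq]
    rw [h0, abs_zero]
    exact ha.le
  · rw [abs_of_pos (B1.aSeq_pos ha hL hj)]
    exact B1.aSeq_le ha hL j hj

/-- The same with `L` a natural number cast to `ℝ` (the form the window theorems take it). [folklore] -/
theorem abs_aSeq_le_nat {a : ℝ} (ha : 0 < a) {L : ℕ} (hL : Odd L ∧ 1 < L) : ∀ j : ℕ, |B1.aSeq a L j| ≤ a :=
  abs_aSeq_le ha (by exact_mod_cast hL.2)

/-- `Odd L ∧ 1 < L` along a tower sequence (from `Params.hL` of its first tower). [folklore] -/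
theorem towerSeq_oddL {L : ℕ} (𝒯 : TowerSeq L) : Odd L ∧ 1 < L := by
  have h := (𝒯.Pf 0).hL
  rwa [𝒯.hL 0] at h

/-- NON-VACUITY: tower sequences exist — e.g. the towers `(d, L, m, K) = (4, L, m, 0)` (exactly `m + 1` levels at index `m`)
read at the base point `0`. [folklore] -/
def stdTowerSeq (L : ℕ) (hL : Odd L ∧ 1 < L) : TowerSeq L where
  Pf := fun m => { d := 4, L := L, m := m, K := 0, hd := by norm_num, hL := hL }
  hd := fun _ => rfl
  hL := fun _ => rfl
  hK := fun m => by simp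
  x₀ := fun _ => fun _ => 0

/-! ## §2. The massless scalar package at `d = 4` -/

/-- THE CONSTANT PACKAGE at `d = 4` for `(L, a)`: block-leg constants `(c₀, δ₀′)` dominating the `K0` thresholds `cK0`, `dK0`
of `SliceLegsLeafK0`, with ONE uniform `BlockLegDecay P a 0 c₀ δ₀′` for every tower `P` with `P.d = 4`, `P.L = L`. [folklore] -/
structure ScalarPkg (L : ℕ) (a : ℝ) where
  c₀ : ℝ
  δ₀' : ℝ
  hc : cK0 4 L a 0 ≤ c₀
  hδ : 0 < δ₀'
  hδ' : δ₀' ≤ dK0 4 L a 0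
  H : ∀ P : Params, P.d = 4 → P.L = L → BlockLegDecay P a 0 c₀ δ₀'

/-- **THE PACKAGE EXISTS** (pv23 `blockLegDecay_massless 4 L` + `BlockLegDecay.mono`). [folklore] -/
theorem scalarPkg_nonempty (L : ℕ) (hL : Odd L ∧ 1 < L) {a : ℝ} (ha : 0 < a) : Nonempty (ScalarPkg L a) := by
  obtain ⟨c, δ, hc, hδ, H⟩ := blockLegDecay_massless 4 L (by norm_num) hL ha
  have hdK0 : 0 < dK0 4 L a 0 := B5Leaf237C0Torus.dK0_pos (P := refParams L hL) ha le_rfl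
  exact ⟨{ c₀ := max c (cK0 4 L a 0)
           δ₀' := min δ (dK0 4 L a 0)
           hc := le_max_right _ _
           hδ := lt_min hδ hdK0
           hδ' := min_le_right _ _
           H := fun P hPd hPL => (H P hPd hPL).mono hc (le_max_left _ _) (min_le_left _ _) }⟩

namespace ScalarPkg

variable {L : ℕ} {a : ℝ} (pkg : ScalarPkg L a)

/-- `0 ≤ c₀` (the `K0` threshold `cK0` is nonnegative). [folklore] -/
theorem c₀_nonneg (hL : Odd L ∧ 1 < L) (ha : 0 < a) : 0 ≤ pkg.c₀ :=
  SliceLegsLeafK0.c₀_nonneg_of_cK0_le (P := refParams L hL) ha pkg.hc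

/-- The uniform package along any tower sequence. [folklore] -/
theorem blockLegDecay (𝒯 : TowerSeq L) (m : ℕ) : BlockLegDecay (𝒯.Pf m) a 0 pkg.c₀ pkg.δ₀' :=
  pkg.H (𝒯.Pf m) (𝒯.hd m) (𝒯.hL m)

/-- THE TAIL CONSTANT of the leg carrying `s` fine-lattice powers (`s = 2` value, `3` gradient, `4` mixed), named on the
reference record: `R_s = legConst (4, L) c₀ δ₀′ a s`. [folklore] -/
def R (hL : Odd L ∧ 1 < L) (s : ℕ) : ℝ := legConst (refParams L hL) pkg.c₀ pkg.δ₀' a s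

/-- `0 ≤ R_s`. [folklore] -/
theorem R_nonneg (hL : Odd L ∧ 1 < L) (ha : 0 < a) (s : ℕ) : 0 ≤ pkg.R hL s :=
  legConst_nonneg (pkg.c₀_nonneg hL ha) pkg.hδ a s

/-- THE TAIL RATE `δ = ⅜δ₀′`. [folklore] -/
def rate : ℝ := 3 / 8 * pkg.δ₀'

/-- `0 < δ`. [folklore] -/
theorem rate_pos : 0 < pkg.rate := by
  unfold rate
  linarith [pkg.hδ]

/-- Along a tower sequence the `legConst` of `SliceLegsWindow` is `R_s`. [folklore] -/
theorem legConst_P₀_eq (𝒯 : TowerSeq L) (s : ℕ) : legConst 𝒯.P₀ pkg.c₀ pkg.δ₀' a s = pkg.R (towerSeq_oddL 𝒯) s :=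
  legConst_eq_of_eq (P := 𝒯.P₀) (P' := refParams L (towerSeq_oddL 𝒯)) (𝒯.hd 0) (𝒯.hL 0) _ _ _ _

/-! ## §3. The six (W3a)₀ tail binders, hypothesis-free -/

/-- **VALUE LEG, `hFtail`, HYPOTHESIS-FREE** (massless scalar tower, `d = 4`, `a = 2`). [folklore] -/
theorem valueF_hFtail (ha : 0 < a) (𝒯 : TowerSeq L) (M : ℕ → ℕ) :
    ∀ m : ℕ, 1 ≤ m → ∀ r : ℕ, M (L ^ m) ≤ r → ∀ w ∈ annulus 4 r (r + 1),
      |𝒯.valueF a 0 (L ^ m) w| ≤ pkg.R (towerSeq_oddL 𝒯) 2 / ((r : ℝ) + 1) ^ 2 *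
        Real.exp (-(pkg.rate / ((L ^ m : ℕ) : ℝ)) * ((r : ℝ) + 1)) := by
  rw [← pkg.legConst_P₀_eq 𝒯]
  exact 𝒯.valueLeg_hFtail ha le_rfl pkg.hc pkg.hδ pkg.hδ' (abs_aSeq_le_nat ha (towerSeq_oddL 𝒯)) (pkg.blockLegDecay 𝒯) M

/-- **VALUE LEG, `hGtail`, HYPOTHESIS-FREE** (`a = 2`). [folklore] -/
theorem valueF_hGtail (ha : 0 < a) (𝒯 : TowerSeq L) (M : ℕ → ℕ) :
    ∀ m : ℕ, 1 ≤ m → ∀ r : ℕ, M (L ^ m) ≤ r → ∀ w ∈ annulus 4 r (r + 1),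
      |𝒯.valueF a 0 (L ^ m) w| ≤ pkg.R (towerSeq_oddL 𝒯) 2 / ((r : ℝ) + 1) ^ 2 := by
  rw [← pkg.legConst_P₀_eq 𝒯]
  exact 𝒯.valueLeg_hGtail ha le_rfl pkg.hc pkg.hδ pkg.hδ' (abs_aSeq_le_nat ha (towerSeq_oddL 𝒯)) (pkg.blockLegDecay 𝒯) M

/-- **GRADIENT LEG, `hFtail`, HYPOTHESIS-FREE** (`a = 3`). [folklore] -/
theorem gradF_hFtail (ha : 0 < a) (𝒯 : TowerSeq L) (μ : Fin 4) (M : ℕ → ℕ) :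
    ∀ m : ℕ, 1 ≤ m → ∀ r : ℕ, M (L ^ m) ≤ r → ∀ w ∈ annulus 4 r (r + 1),
      |𝒯.gradF a 0 μ (L ^ m) w| ≤ pkg.R (towerSeq_oddL 𝒯) 3 / ((r : ℝ) + 1) ^ 3 *
        Real.exp (-(pkg.rate / ((L ^ m : ℕ) : ℝ)) * ((r : ℝ) + 1)) := by
  rw [← pkg.legConst_P₀_eq 𝒯]
  exact 𝒯.gradLeg_hFtail ha le_rfl pkg.hc pkg.hδ pkg.hδ' (abs_aSeq_le_nat ha (towerSeq_oddL 𝒯)) (pkg.blockLegDecay 𝒯) μ M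

/-- **GRADIENT LEG, `hGtail`, HYPOTHESIS-FREE** (`a = 3`). [folklore] -/
theorem gradF_hGtail (ha : 0 < a) (𝒯 : TowerSeq L) (μ : Fin 4) (M : ℕ → ℕ) :
    ∀ m : ℕ, 1 ≤ m → ∀ r : ℕ, M (L ^ m) ≤ r → ∀ w ∈ annulus 4 r (r + 1),
      |𝒯.gradF a 0 μ (L ^ m) w| ≤ pkg.R (towerSeq_oddL 𝒯) 3 / ((r : ℝ) + 1) ^ 3 := by
  rw [← pkg.legConst_P₀_eq 𝒯]
  exact 𝒯.gradLeg_hGtail ha le_rfl pkg.hc pkg.hδ pkg.hδ' (abs_aSeq_le_nat ha (towerSeq_oddL 𝒯)) (pkg.blockLegDecay 𝒯) μ M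

/-- **MIXED LEG, `hFtail`, HYPOTHESIS-FREE** (`a = 4`). [folklore] -/
theorem mixedF_hFtail (ha : 0 < a) (𝒯 : TowerSeq L) (μ ν : Fin 4) (M : ℕ → ℕ) :
    ∀ m : ℕ, 1 ≤ m → ∀ r : ℕ, M (L ^ m) ≤ r → ∀ w ∈ annulus 4 r (r + 1),
      |𝒯.mixedF a 0 μ ν (L ^ m) w| ≤ pkg.R (towerSeq_oddL 𝒯) 4 / ((r : ℝ) + 1) ^ 4 *
        Real.exp (-(pkg.rate / ((L ^ m : ℕ) : ℝ)) * ((r : ℝ) + 1)) := by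
  rw [← pkg.legConst_P₀_eq 𝒯]
  exact 𝒯.mixedLeg_hFtail ha le_rfl pkg.hc pkg.hδ pkg.hδ' (abs_aSeq_le_nat ha (towerSeq_oddL 𝒯)) (pkg.blockLegDecay 𝒯) μ ν M

/-- **MIXED LEG, `hGtail`, HYPOTHESIS-FREE** (`a = 4`). [folklore] -/
theorem mixedF_hGtail (ha : 0 < a) (𝒯 : TowerSeq L) (μ ν : Fin 4) (M : ℕ → ℕ) :
    ∀ m : ℕ, 1 ≤ m → ∀ r : ℕ, M (L ^ m) ≤ r → ∀ w ∈ annulus 4 r (r + 1),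
      |𝒯.mixedF a 0 μ ν (L ^ m) w| ≤ pkg.R (towerSeq_oddL 𝒯) 4 / ((r : ℝ) + 1) ^ 4 := by
  rw [← pkg.legConst_P₀_eq 𝒯]
  exact 𝒯.mixedLeg_hGtail ha le_rfl pkg.hc pkg.hδ pkg.hδ' (abs_aSeq_le_nat ha (towerSeq_oddL 𝒯)) (pkg.blockLegDecay 𝒯) μ ν M

end ScalarPkg

/-! ## §4. Summary: constants from `(L, a)` alone, then every tower sequence and every window floor -/

/-- **(W3a)₀ TAILS OF THE MASSLESS SCALAR TOWER, HYPOTHESIS-FREE.**  For odd `L > 1` and `a > 0` there are `δ > 0` and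
`R₂, R₃, R₄ ≥ 0` (from `(L, a)` alone) such that along EVERY tower sequence `𝒯 : TowerSeq L` and for EVERY window floor `M`
the six tail binders of `ComposedRoad.oneLoopDrift_of_composedLegInterfacePow` hold for the value (`a = 2`), gradient
(`a = 3`) and mixed (`a = 4`) legs read as `Pt`-families (`SliceLegsWindow`). [folklore] -/
theorem scalarTails (L : ℕ) (hL : Odd L ∧ 1 < L) {a : ℝ} (ha : 0 < a) :
    ∃ δ R₂ R₃ R₄ : ℝ, 0 < δ ∧ 0 ≤ R₂ ∧ 0 ≤ R₃ ∧ 0 ≤ R₄ ∧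
      ∀ (𝒯 : TowerSeq L) (M : ℕ → ℕ),
        (∀ m : ℕ, 1 ≤ m → ∀ r : ℕ, M (L ^ m) ≤ r → ∀ w ∈ annulus 4 r (r + 1),
          |𝒯.valueF a 0 (L ^ m) w| ≤ R₂ / ((r : ℝ) + 1) ^ 2 * Real.exp (-(δ / ((L ^ m : ℕ) : ℝ)) * ((r : ℝ) + 1))) ∧
        (∀ m : ℕ, 1 ≤ m → ∀ r : ℕ, M (L ^ m) ≤ r → ∀ w ∈ annulus 4 r (r + 1),
          |𝒯.valueF a 0 (L ^ m) w| ≤ R₂ / ((r : ℝ) + 1) ^ 2) ∧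
        (∀ μ : Fin 4, ∀ m : ℕ, 1 ≤ m → ∀ r : ℕ, M (L ^ m) ≤ r → ∀ w ∈ annulus 4 r (r + 1),
          |𝒯.gradF a 0 μ (L ^ m) w| ≤ R₃ / ((r : ℝ) + 1) ^ 3 * Real.exp (-(δ / ((L ^ m : ℕ) : ℝ)) * ((r : ℝ) + 1))) ∧
        (∀ μ : Fin 4, ∀ m : ℕ, 1 ≤ m → ∀ r : ℕ, M (L ^ m) ≤ r → ∀ w ∈ annulus 4 r (r + 1),
          |𝒯.gradF a 0 μ (L ^ m) w| ≤ R₃ / ((r : ℝ) + 1) ^ 3) ∧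
        (∀ μ ν : Fin 4, ∀ m : ℕ, 1 ≤ m → ∀ r : ℕ, M (L ^ m) ≤ r → ∀ w ∈ annulus 4 r (r + 1),
          |𝒯.mixedF a 0 μ ν (L ^ m) w| ≤ R₄ / ((r : ℝ) + 1) ^ 4 * Real.exp (-(δ / ((L ^ m : ℕ) : ℝ)) * ((r : ℝ) + 1))) ∧
        (∀ μ ν : Fin 4, ∀ m : ℕ, 1 ≤ m → ∀ r : ℕ, M (L ^ m) ≤ r → ∀ w ∈ annulus 4 r (r + 1),
          |𝒯.mixedF a 0 μ ν (L ^ m) w| ≤ R₄ / ((r : ℝ) + 1) ^ 4) := by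
  obtain ⟨pkg⟩ := scalarPkg_nonempty L hL ha
  refine ⟨pkg.rate, pkg.R hL 2, pkg.R hL 3, pkg.R hL 4, pkg.rate_pos, pkg.R_nonneg hL ha 2, pkg.R_nonneg hL ha 3,
    pkg.R_nonneg hL ha 4, fun 𝒯 M => ⟨?_, ?_, ?_, ?_, ?_, ?_⟩⟩
  · exact pkg.valueF_hFtail ha 𝒯 M
  · exact pkg.valueF_hGtail ha 𝒯 M
  · exact fun μ => pkg.gradF_hFtail ha 𝒯 μ M
  · exact fun μ => pkg.gradF_hGtail ha 𝒯 μ M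
  · exact fun μ ν => pkg.mixedF_hFtail ha 𝒯 μ ν M
  · exact fun μ ν => pkg.mixedF_hGtail ha 𝒯 μ ν M

end Beta.SliceLegsScalar

end

end Literature.MathematicalPhysics.QuantumFieldTheory.Balaban1983to89
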